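import Summits.Ventures.PercRepro.RankLevelSetLevelSixT22Cell11
import Summits.Ventures.PercRepro.RankLevelSetLevelSixT22Cell12
import Summits.Ventures.PercRepro.RankLevelSetLevelSixT22Free11Le20
import Summits.Ventures.PercRepro.RankLevelSetLevelSixT22Free12Le21
import Summits.Ventures.PercRepro.RankLevelSetLevelSixT22S1Cf12Le26
import Summits.Ventures.PercRepro.RankLevelSetLevelSixT22Assembly

/-!
# PercRepro — THE 22 ROW MODULO TWO MANY-TRIANGLE STATEMENTS (p8 g14, S3): the gap narrowed by the re-priced existing cell

The three branch statements of RankLevelSetLevelSixT22AssemblyBranches were priced by a script carrying the older `H`-term factor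
`n − 5 − ν₁`; the typed cell `sq27di2v` has the factor `n − |UH|` (RankLevelSetHeavyWindowFactor), worth `≈ 4 %` of `#U` at the
22 row. Re-priced on the typed cell: the coloop-free cell `(22, 11)` closes for `s₃ ≤ 20` (`c025_core_six_t22_free11_le20`, ratio 0.994),
the coloop-free cell `(22, 12)` for `s₃ ≤ 21` (`c025_core_six_t22_free12_le21`, 0.993), and the `1`-scaled coloop-free cell `(21, 12)@7`
for `s₃ ≤ 26` = its triangle cap (`c025_core_six_t22_scaled1_cf12_le26`, 0.971) — so the third statement `h12t` is DISCHARGED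
(`c025_core_six_t22_scaled1_cf12`), and the 22 row is a theorem modulo exactly TWO statements about coloop-free `e`-free cores with
many triangles: `(r, |E|, s₃) ∈ {(22, 33, ≥ 21), (22, 34, ≥ 22)}` (`c025_six_large_twenty_two_of_two`). Axioms: standard.
-/

open scoped Matroid

namespace PercRepro

namespace ThmN

variable {α : Type}

/-- **The `1`-scaled coloop-free cell `(21, 12)@7`, UNCONDITIONAL**: `Φ(22, 6)/2 · #U(N, 21, 6) ≤ #Y(N, 21, 6)` on every coloop-free
`e`-free core of rank `21` with `33` points (the triangle cap `s₃ ≤ 26` of the coloop-free step discharges the branch hypothesis). -/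
theorem c025_core_six_t22_scaled1_cf12 (N : Matroid α) [N.Finite] (hcf : ∀ e ∈ N.E, ¬ N.IsColoop e)
    (hRN : N.eRank = (21 : ℕ∞)) (hnN : N.E.ncard = 21 + 12)
    (hfreeN : ∀ e ∈ N.E, ∃ A ⊆ N.E \ {e}, e ∉ N.closure A ∧ e ∉ N.closure ((N.E \ {e}) \ A)) :
    phiK 22 6 / 2 ^ 1 * (Matroid.topCount N 21 6 : ℚ) ≤ (Matroid.midCount N 21 6 : ℚ) := by
  have hd : N.E.encard = N.eRank + (12 : ℕ) := by
    rw [hRN, ← N.ground_finite.cast_ncard_eq, hnN]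
    push_cast
    ring
  have h26 : {C : Set α | N.IsCircuit C ∧ C.ncard = 3}.ncard ≤ 26 :=
    s3_cf_of N hfreeN hcf (d := 11) (by simpa using hd) 33 26 (by norm_num) (by omega) (by decide) (by decide) (by decide)
  have := c025_core_six_t22_scaled1_cf12_le26 N 21 le_rfl hcf h26 hRN hnN hfreeN
  simpa using this

/-- **The cell `(22, 11)` modulo the branch `s₃ ≥ 21` of its coloop-free cell** (the branch `s₃ ≤ 20` closes on the re-priced cell). -/
theorem c025_core_six_twentytwo_11_of_many21 (M : Matroid α) [M.Finite]
    (hR : M.eRank = (22 : ℕ∞)) (hn : M.E.ncard = 22 + 11)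
    (hfree : ∀ e ∈ M.E, ∃ A ⊆ M.E \ {e}, e ∉ M.closure A ∧ e ∉ M.closure ((M.E \ {e}) \ A))
    (h21 : ∀ N : Matroid α, ∀ [N.Finite], (∀ e ∈ N.E, ¬ N.IsColoop e) → N.eRank = (22 : ℕ∞) → N.E.ncard = 22 + 11 →
      (∀ e ∈ N.E, ∃ A ⊆ N.E \ {e}, e ∉ N.closure A ∧ e ∉ N.closure ((N.E \ {e}) \ A)) →
      21 ≤ {C : Set α | N.IsCircuit C ∧ C.ncard = 3}.ncard → RLS N 22 6) : RLS M 22 6 := by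
  refine c025_core_six_twentytwo_11_of_free M hR hn hfree ?_
  intro N _ hcf hRN hnN hfreeN
  by_cases h20 : {C : Set α | N.IsCircuit C ∧ C.ncard = 3}.ncard ≤ 20
  · exact c025_core_six_t22_free11_le20 N 22 le_rfl hcf h20 hRN hnN hfreeN
  · exact h21 N hcf hRN hnN hfreeN (by omega)

/-- **The cell `(22, 12)` modulo the branch `s₃ ≥ 22` of its coloop-free cell** (the branch `s₃ ≤ 21` closes on the re-priced cell; the
`1`-scaled cell at rank `21` is a theorem). -/
theorem c025_core_six_twentytwo_12_of_many22 (M : Matroid α) [M.Finite]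
    (hR : M.eRank = (22 : ℕ∞)) (hn : M.E.ncard = 22 + 12)
    (hfree : ∀ e ∈ M.E, ∃ A ⊆ M.E \ {e}, e ∉ M.closure A ∧ e ∉ M.closure ((M.E \ {e}) \ A))
    (h22 : ∀ N : Matroid α, ∀ [N.Finite], (∀ e ∈ N.E, ¬ N.IsColoop e) → N.eRank = (22 : ℕ∞) → N.E.ncard = 22 + 12 →
      (∀ e ∈ N.E, ∃ A ⊆ N.E \ {e}, e ∉ N.closure A ∧ e ∉ N.closure ((N.E \ {e}) \ A)) →
      22 ≤ {C : Set α | N.IsCircuit C ∧ C.ncard = 3}.ncard → RLS N 22 6) : RLS M 22 6 := by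
  refine c025_core_six_twentytwo_12_of_free M hR hn hfree ?_
    (fun N _ hcf hRN hnN hfreeN => c025_core_six_t22_scaled1_cf12 N hcf hRN hnN hfreeN)
  intro N _ hcf hRN hnN hfreeN
  by_cases h21 : {C : Set α | N.IsCircuit C ∧ C.ncard = 3}.ncard ≤ 21
  · exact c025_core_six_t22_free12_le21 N 22 le_rfl hcf h21 hRN hnN hfreeN
  · exact h22 N hcf hRN hnN hfreeN (by omega)

/-- **C-025 AT LEVEL `6` FOR EVERY `p ≥ 22` MODULO TWO MANY-TRIANGLE STATEMENTS** — coloop-free `e`-free cores of rank `22` with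
`|E| = 33` and `≥ 21` triangles, or `|E| = 34` and `≥ 22` triangles. -/
theorem c025_six_large_twenty_two_of_two
    (h11 : ∀ N : Matroid α, ∀ [N.Finite], (∀ e ∈ N.E, ¬ N.IsColoop e) → N.eRank = (22 : ℕ∞) → N.E.ncard = 22 + 11 →
      (∀ e ∈ N.E, ∃ A ⊆ N.E \ {e}, e ∉ N.closure A ∧ e ∉ N.closure ((N.E \ {e}) \ A)) →
      21 ≤ {C : Set α | N.IsCircuit C ∧ C.ncard = 3}.ncard → RLS N 22 6)
    (h12 : ∀ N : Matroid α, ∀ [N.Finite], (∀ e ∈ N.E, ¬ N.IsColoop e) → N.eRank = (22 : ℕ∞) → N.E.ncard = 22 + 12 →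
      (∀ e ∈ N.E, ∃ A ⊆ N.E \ {e}, e ∉ N.closure A ∧ e ∉ N.closure ((N.E \ {e}) \ A)) →
      22 ≤ {C : Set α | N.IsCircuit C ∧ C.ncard = 3}.ncard → RLS N 22 6)
    (M : Matroid α) [M.Finite] (p : ℕ) (hp : 22 ≤ p) : RLS M p 6 :=
  c025_six_large_twenty_two_of
    (fun N _ hRN hnN hfreeN => c025_core_six_twentytwo_11_of_many21 N hRN hnN hfreeN h11)
    (fun N _ hRN hnN hfreeN => c025_core_six_twentytwo_12_of_many22 N hRN hnN hfreeN h12) M p hp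

end ThmN

end PercRepro
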